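import Literature.GroupTheory.CombinatorialGroupTheory.CyclicBlockInterchangeTransport
import HarnessLib

/-!
# Tracking positions through a sequence of cyclic block interchanges (towards Heuer 2020, Lemma 4.6)

[Heuer2020, Lemma 4.6] (§4.2) transfers the cyclic block interchange distance along the binary
encoding `λ` by following the *copies* of the letter codes through an optimal sequence of
interchanges: "every cyclic block transformation cuts the words in at most `4` places", copies
that are never cut move as units, and "by recording the cyclic block interchanges we get a
bijection" between surviving copies and their landing places. This file provides that bookkeeping
for the vocabulary of `CyclicBlockInterchange.lean`:

* **step maps** (`CBI.exists_stepMap`): a cyclic block interchange `u ↦ u'` of words of length `N`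
  is realised by a position permutation `ψ` (`u'[ψ x] = u[x]`) that commutes with the rotation
  `σ` off a set `C` of at most four *cut points*;
* **translation of uncut intervals** (`CBI.stepMap_pow_apply`): an interval none of whose interior
  points is a cut point is carried rigidly, `ψ(σᵒ p) = σᵒ ψ(p)`;
* **the induced interchange on marked points** (`CBI.isCBI_sortedLabels`): for ANY finite family of
  marked positions with labels, the labels read in positional order before and after the step
  differ by a cyclic block interchange (the block map is increasing on each block, rotations
  rotate the reading);
* **tracking along a sequence** (`CBI.exists_track`): along `Reach t`, the composite position map,
  the transported letters, a set of *surviving* intervals of any prescribed disjoint family with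
  at most `4t` casualties, rigid motion of the survivors, and `Reach t` between the label readings
  of every sub-family of marked points.

Everything here is proved; no named facts.

## References

* [Heuer2020] N. Heuer, *Computing commutator length is hard*, arXiv:2001.10230, §4.2 (Lemma 4.6,
  Claim 4.7).
-/

namespace Literature.GroupTheory.CombinatorialGroupTheory

namespace CBI

open Equiv Equiv.Perm

universe u

variable {N : ℕ} {γ : Type*}

/-! ### Step maps -/

/-- `IsStepMap ψ C`: `ψ` commutes with the rotation off the cut set `C`, which has at most four
points. [cite: Heuer2020, Lemma 4.6] -/
def IsStepMap (ψ : Perm (Fin N)) (C : Finset (Fin N)) : Prop :=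
  C.card ≤ 4 ∧ ∀ x, x ∉ C → ψ (finRotate N x) = finRotate N (ψ x)

/-- Rotations are step maps without cut points. [folklore] -/
theorem isStepMap_pow (k : ℕ) : IsStepMap (finRotate N ^ k) ∅ :=
  ⟨by simp, fun x _ => pow_finRotate_comm k x⟩

/-- Inverse rotations are step maps without cut points. [folklore] -/
theorem isStepMap_pow_inv (k : ℕ) : IsStepMap (finRotate N ^ k)⁻¹ ∅ :=
  ⟨by simp, fun x _ => pow_finRotate_inv_comm k x⟩

/-- **The block map is a step map**, cut points `σ⁻¹{0, a, a+b, a+b+c}`. [cite: Heuer2020, Claim 3.8] -/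
theorem isStepMap_blockPerm {a b c d : ℕ} (hn : N = a + b + c + d) :
    IsStepMap (blockPerm a b c d N hn)
      (Finset.univ.filter fun x : Fin N =>
        blockPerm a b c d N hn (finRotate N x) ≠ finRotate N (blockPerm a b c d N hn x)) := by
  refine ⟨?_, fun x hx => ?_⟩
  · -- inject into the cut filter of `CyclicBlockInterchangeTransport` by `σ`
    have h := card_cut_blockPerm_le (n := N) hn
    refine le_trans ?_ h
    refine Finset.card_le_card_of_injOn (fun x => finRotate N x) (fun x hx => ?_) (fun x _ y _ hxy => (finRotate N).injective hxy)
    rw [Finset.mem_coe, Finset.mem_filter] at hx ⊢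
    refine ⟨Finset.mem_univ _, ?_⟩
    rw [Equiv.symm_apply_apply]
    exact hx.2
  · by_contra h
    exact hx (Finset.mem_filter.2 ⟨Finset.mem_univ _, h⟩)

/-- Composition of step maps: cut sets add up (pulled back). [folklore] -/
theorem IsStepMap.mul {ψ₁ ψ₂ : Perm (Fin N)} {C₁ C₂ : Finset (Fin N)} (h₂ : IsStepMap ψ₂ C₂) (h₁ : IsStepMap ψ₁ C₁)
    (hcard : C₁.card + C₂.card ≤ 4) :
    IsStepMap (ψ₂ * ψ₁) (C₁ ∪ C₂.map ψ₁.symm.toEmbedding) := by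
  refine ⟨(Finset.card_union_le _ _).trans (by rwa [Finset.card_map]), fun x hx => ?_⟩
  rw [Finset.mem_union, not_or, Finset.mem_map] at hx
  rw [Perm.mul_apply, Perm.mul_apply, h₁.2 x hx.1, h₂.2]
  intro h
  exact hx.2 ⟨ψ₁ x, h, by simp⟩

/-! ### Translation of uncut intervals -/

/-- **An interval none of whose interior points is a cut point moves rigidly**:
`ψ(σᵒ p) = σᵒ ψ(p)` for `o < L` when `σᵒ p ∉ C` for `o < L − 1` ("copies which do not get cut",
[Heuer2020, proof of Lemma 4.6]). [cite: Heuer2020, Lemma 4.6] -/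
theorem stepMap_pow_apply {ψ : Perm (Fin N)} {C : Finset (Fin N)} (h : IsStepMap ψ C) (p : Fin N) {L : ℕ}
    (hcut : ∀ o, o + 1 < L → (finRotate N ^ o) p ∉ C) : ∀ o, o < L → ψ ((finRotate N ^ o) p) = (finRotate N ^ o) (ψ p)
  | 0, _ => by simp
  | o + 1, ho => by
    rw [pow_succ', Perm.mul_apply, h.2 _ (hcut o ho), stepMap_pow_apply h p hcut o (Nat.lt_of_succ_lt ho), Perm.mul_apply]

/-! ### Markings and their readings -/

variable {β : Type*}

/-- The labels of a marking `M : Fin N → Option β`, read in positional order. [folklore] -/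
def readMarks (M : Fin N → Option β) : List β := (List.finRange N).filterMap M

/-- Reading a re-indexed marking: push the re-indexing into the list of positions. [folklore] -/
theorem readMarks_comp (M : Fin N → Option β) (f : Fin N → Fin N) :
    readMarks (M ∘ f) = ((List.finRange N).map f).filterMap M := by
  rw [readMarks, List.filterMap_map]

/-- The positions re-indexed by a power of the rotation form a rotation of the positions. [folklore] -/
theorem map_finRotate_pow_finRange (k : ℕ) :
    (List.finRange N).map ⇑(finRotate N ^ k) = (List.finRange N).rotate k := by
  apply List.ext_getElem
  · simp
  · intro i h1 h2
    rw [List.getElem_map, List.getElem_finRange, List.getElem_rotate, List.getElem_finRange]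
    apply Fin.ext
    rw [Bardakov.val_finRotate_pow]
    simp

/-- An inverse power of the rotation is a power of the rotation. [folklore] -/
theorem exists_pow_eq_inv_pow (k : ℕ) : ∃ m : ℕ, (finRotate N ^ k)⁻¹ = finRotate N ^ m := by
  rcases Nat.eq_zero_or_pos N with rfl | hN
  · exact ⟨0, Subsingleton.elim _ _⟩
  · refine ⟨N - k % N, ?_⟩
    rw [inv_eq_iff_mul_eq_one, ← pow_add]
    refine Equiv.ext fun x => Fin.ext ?_
    rw [Bardakov.val_finRotate_pow, Perm.one_apply]
    have hk : k = k % N + N * (k / N) := (Nat.mod_add_div k N).symm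
    have ht : k % N < N := Nat.mod_lt k hN
    have e : x.val + (k + (N - k % N)) = x.val + N * (k / N + 1) := by
      rw [Nat.mul_succ]
      omega
    rw [e, Nat.add_mul_mod_self_left, Nat.mod_eq_of_lt x.isLt]

/-- **Rotating the marking rotates the reading.** [folklore] -/
theorem readMarks_comp_pow_isRotated (M : Fin N → Option β) (k : ℕ) :
    List.IsRotated (readMarks (M ∘ ⇑(finRotate N ^ k))) (readMarks M) := by
  rw [readMarks_comp, map_finRotate_pow_finRange]
  obtain ⟨m, hm, h⟩ := List.isRotated_iff_mod.1 (List.IsRotated.forall (List.finRange N) k)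
  -- `finRange = A ++ B`, rotation `= B ++ A`; `filterMap` is append-multiplicative
  have hsplit : (List.finRange N).rotate k = (List.finRange N).drop (k % (List.finRange N).length) ++
      (List.finRange N).take (k % (List.finRange N).length) := by
    rw [List.length_finRange]
    rcases Nat.eq_zero_or_pos N with hN | hN
    · subst hN; simp
    · conv_lhs => rw [← List.rotate_mod, List.length_finRange]
      exact List.rotate_eq_drop_append_take (by rw [List.length_finRange]; exact (Nat.mod_lt _ hN).le)
  rw [hsplit, List.filterMap_append, readMarks]
  conv_rhs => rw [← List.take_append_drop (k % (List.finRange N).length) (List.finRange N), List.filterMap_append]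
  exact List.isRotated_append

/-- **Rotating the marking backwards rotates the reading.** [folklore] -/
theorem readMarks_comp_pow_inv_isRotated (M : Fin N → Option β) (k : ℕ) :
    List.IsRotated (readMarks (M ∘ ⇑(finRotate N ^ k)⁻¹)) (readMarks M) := by
  obtain ⟨m, hm⟩ := exists_pow_eq_inv_pow (N := N) k
  rw [hm]
  exact readMarks_comp_pow_isRotated M m

/-- The old positions listed in the order `block 1, block 4, block 3, block 2`, by value. [cite: Heuer2020, §3.2.3] -/
theorem map_blockInv_range {a b c d : ℕ} (hn : N = a + b + c + d) :
    (List.range N).map (blockInv a b c d) =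
      (List.range N).take a ++ (List.range N).drop (a + b + c) ++ ((List.range N).drop (a + b)).take c ++
        ((List.range N).drop a).take b := by
  apply List.ext_getElem
  · simp only [List.length_map, List.length_range, List.length_append, List.length_take, List.length_drop]
    omega
  · intro i h1 h2
    rw [List.getElem_map, List.getElem_range, getElem_append4]
    simp only [List.length_take, List.length_drop, List.length_range, List.getElem_take, List.getElem_drop,
      List.getElem_range]
    rw [List.length_map, List.length_range] at h1
    unfold blockInv
    by_cases c1 : i < a
    · rw [if_pos c1, dif_pos (by omega)]
    by_cases c2 : i < a + d
    · rw [if_neg c1, if_pos c2, dif_neg (by omega), dif_pos (by omega)]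
      omega
    by_cases c3 : i < a + d + c
    · rw [if_neg c1, if_neg c2, if_pos c3, dif_neg (by omega), dif_neg (by omega), dif_pos (by omega)]
      omega
    · rw [if_neg c1, if_neg c2, if_neg c3, dif_neg (by omega), dif_neg (by omega), dif_neg (by omega)]
      omega

/-- The positions re-indexed by the inverse block map: old positions in the order
`block 1, block 4, block 3, block 2`. [cite: Heuer2020, §3.2.3] -/
theorem map_blockPerm_symm_finRange {a b c d : ℕ} (hn : N = a + b + c + d) :
    (List.finRange N).map ⇑(blockPerm a b c d N hn).symm =
      (List.finRange N).take a ++ ((List.finRange N).drop (a + b + c)) ++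
        (((List.finRange N).drop (a + b)).take c) ++ (((List.finRange N).drop a).take b) := by
  apply List.map_injective_iff.2 Fin.val_injective
  rw [List.map_map, show Fin.val ∘ ⇑(blockPerm a b c d N hn).symm = blockInv a b c d ∘ Fin.val from rfl,
    ← List.map_map, List.map_coe_finRange_eq_range, map_blockInv_range hn]
  simp only [List.map_append, List.map_take, List.map_drop, List.map_coe_finRange_eq_range]

/-- **The block map induces a block interchange of every reading.** [cite: Heuer2020, Lemma 4.6] -/
theorem isBlockInterchange_readMarks_blockPerm (M : Fin N → Option β) {a b c d : ℕ} (hn : N = a + b + c + d) :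
    IsBlockInterchange (readMarks M) (readMarks (M ∘ ⇑(blockPerm a b c d N hn).symm)) := by
  rw [readMarks_comp, map_blockPerm_symm_finRange, readMarks]
  conv_lhs => rw [← List.take_append_drop a (List.finRange N), ← List.take_append_drop b ((List.finRange N).drop a),
    List.drop_drop, ← List.take_append_drop c ((List.finRange N).drop (a + b)), List.drop_drop]
  simp only [List.filterMap_append, List.append_assoc]
  exact ⟨((List.finRange N).take a).filterMap M, (((List.finRange N).drop a).take b).filterMap M,
    (((List.finRange N).drop (a + b)).take c).filterMap M, ((List.finRange N).drop (a + b + c)).filterMap M,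
    by simp only [List.append_assoc], by simp only [List.append_assoc]⟩

/-- **A step `σ⁻ᵏ² γ σᵏ¹` induces a cyclic block interchange of every reading.** [cite: Heuer2020, Lemma 4.6] -/
theorem isCBI_readMarks_step (M : Fin N → Option β) {a b c d : ℕ} (hn : N = a + b + c + d) (k₁ k₂ : ℕ) :
    IsCBI (readMarks M) (readMarks (M ∘ ⇑((finRotate N ^ k₂)⁻¹ * blockPerm a b c d N hn * finRotate N ^ k₁).symm)) := by
  -- `ψ⁻¹ = σ^{-k₁} ∘ γ⁻¹ ∘ σ^{k₂}` as functions: peel the three layers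
  have e : (⇑((finRotate N ^ k₂)⁻¹ * blockPerm a b c d N hn * finRotate N ^ k₁).symm : Fin N → Fin N) =
      ⇑(finRotate N ^ k₁)⁻¹ ∘ ⇑(blockPerm a b c d N hn).symm ∘ ⇑(finRotate N ^ k₂) := by
    funext x
    simp [Perm.mul_def, Perm.inv_def]
  rw [e, ← Function.comp_assoc, ← Function.comp_assoc]
  set M₁ := M ∘ ⇑(finRotate N ^ k₁)⁻¹ with hM₁
  set M₂ := M₁ ∘ ⇑(blockPerm a b c d N hn).symm with hM₂
  have h1 : List.IsRotated (readMarks M₁) (readMarks M) := readMarks_comp_pow_inv_isRotated M k₁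
  have h2 : IsBlockInterchange (readMarks M₁) (readMarks M₂) := isBlockInterchange_readMarks_blockPerm M₁ hn
  have h3 : List.IsRotated (readMarks (M₂ ∘ ⇑(finRotate N ^ k₂))) (readMarks M₂) := readMarks_comp_pow_isRotated M₂ k₂
  exact ⟨readMarks M₁, readMarks M₂, h1, h3.symm, h2⟩

/-! ### Step maps of cyclic block interchanges -/

/-- **A cyclic block interchange is realised by a step map**: `u'[ψ x] = u[x]` with `ψ` commuting with
`σ` off at most four cut points ("every cyclic block transformation cuts the word in at most `4`
places", [Heuer2020, proof of Lemma 4.6]). [cite: Heuer2020, Lemma 4.6] -/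
theorem exists_stepMap {U U' : Fin N → γ} (h : IsCBI (List.ofFn U) (List.ofFn U')) :
    ∃ (ψ : Perm (Fin N)) (C : Finset (Fin N)), IsStepMap ψ C ∧ (∀ x, U' (ψ x) = U x) ∧
      ∀ (β : Type u) (M : Fin N → Option β), IsCBI (readMarks M) (readMarks (M ∘ ⇑ψ.symm)) := by
  obtain ⟨v₀, w₀, hv₀, hw₀, hbi⟩ := h
  obtain ⟨V₀, k₁, rfl, hV⟩ := exists_comp_pow_of_isRotated hv₀
  obtain ⟨W₀, k₂, rfl, hW⟩ := exists_comp_pow_of_isRotated hw₀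
  obtain ⟨w₁, w₂, w₃, w₄, hv, hu⟩ := hbi
  have hn : N = w₁.length + w₂.length + w₃.length + w₄.length := by
    have := congrArg List.length hv
    simp only [List.length_ofFn, List.length_append] at this
    omega
  set γ₀ := blockPerm w₁.length w₂.length w₃.length w₄.length N hn with hγ₀
  -- letters: `W₀ (γ₀ y) = V₀ y`
  have hWV : ∀ y, W₀ (γ₀ y) = V₀ y := by
    intro y
    have hV' : V₀ y = (List.ofFn V₀)[y.val]'(by rw [List.length_ofFn]; exact y.isLt) := by rw [List.getElem_ofFn]
    have hW' : W₀ (γ₀ y) = (List.ofFn W₀)[(γ₀ y).val]'(by rw [List.length_ofFn]; exact (γ₀ y).isLt) := by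
      rw [List.getElem_ofFn]
    rw [hV', hW', List.getElem_of_eq hu, List.getElem_of_eq hv]
    exact getElem_interchange_blockFun w₁ w₂ w₃ w₄ rfl rfl rfl rfl y.val (by simp only [List.length_append]; omega)
      (by have := @blockFun_lt w₁.length w₂.length w₃.length w₄.length y.val (by omega)
          simp only [List.length_append]; omega)
  have h1 : IsStepMap (γ₀ * finRotate N ^ k₁) _ :=
    (isStepMap_blockPerm hn).mul (isStepMap_pow k₁)
      (by rw [Finset.card_empty, Nat.zero_add]; exact (isStepMap_blockPerm (N := N) hn).1)
  have h2 : IsStepMap ((finRotate N ^ k₂)⁻¹ * (γ₀ * finRotate N ^ k₁)) _ :=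
    (isStepMap_pow_inv k₂).mul h1 (by rw [Finset.card_empty, Nat.add_zero]; exact h1.1)
  refine ⟨_, _, h2, fun x => ?_, fun β M => ?_⟩
  · rw [Perm.mul_apply, Perm.mul_apply, hW, Function.comp_apply, Perm.inv_def, Equiv.apply_symm_apply, hWV, hV,
      Function.comp_apply]
  · rw [← mul_assoc]
    exact isCBI_readMarks_step M hn k₁ k₂


/-! ### Tracking a family of intervals along a sequence of interchanges -/

section Track

variable {ι : Type*} [DecidableEq ι]

/-- `Disjoint' start len A`: the intervals `{σᵒ(start κ) : o < len κ}`, `κ ∈ A`, are pairwise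
disjoint. [folklore] -/
def DisjointIv (start : ι → Fin N) (len : ι → ℕ) (A : Finset ι) : Prop :=
  ∀ κ ∈ A, ∀ κ' ∈ A, κ ≠ κ' → ∀ o, o < len κ → ∀ o', o' < len κ' →
    (finRotate N ^ o) (start κ) ≠ (finRotate N ^ o') (start κ')

/-- `Cut C start len κ`: an interior point of the interval `κ` is a cut point. [cite: Heuer2020, Lemma 4.6] -/
def Cut (C : Finset (Fin N)) (start : ι → Fin N) (len : ι → ℕ) (κ : ι) : Prop :=
  ∃ o, o + 1 < len κ ∧ (finRotate N ^ o) (start κ) ∈ C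

/-- **Each step cuts at most four of a family of disjoint intervals** (one per cut point). [cite: Heuer2020, Lemma 4.6] -/
theorem card_filter_cut_le {C : Finset (Fin N)} (hC : C.card ≤ 4) {start : ι → Fin N} {len : ι → ℕ}
    {A : Finset ι} (hd : DisjointIv start len A) [DecidablePred (Cut C start len)] :
    (A.filter (Cut C start len)).card ≤ 4 := by
  classical
  refine le_trans ?_ hC
  -- the witness point of a cut interval
  let f : ι → Fin N := fun κ => if h : Cut C start len κ then (finRotate N ^ Classical.choose h) (start κ) else start κ
  refine Finset.card_le_card_of_injOn f (fun κ hκ => ?_) ?_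
  · rw [Finset.mem_coe, Finset.mem_filter] at hκ
    simp only [f, dif_pos hκ.2]
    exact (Classical.choose_spec hκ.2).2
  · intro κ hκ κ' hκ' hff
    rw [Finset.mem_coe, Finset.mem_filter] at hκ hκ'
    by_contra hne
    simp only [f, dif_pos hκ.2, dif_pos hκ'.2] at hff
    exact hd κ hκ.1 κ' hκ'.1 hne _ (by have := (Classical.choose_spec hκ.2).1; omega) _
      (by have := (Classical.choose_spec hκ'.2).1; omega) hff

omit [DecidableEq ι] in
/-- Disjointness of the uncut intervals is preserved by a step (they move rigidly, `ψ` is injective). [folklore] -/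
theorem DisjointIv.step {ψ : Perm (Fin N)} {C : Finset (Fin N)} (hψ : IsStepMap ψ C) {start : ι → Fin N} {len : ι → ℕ}
    {A : Finset ι} (hd : DisjointIv start len A) [DecidablePred (Cut C start len)] :
    DisjointIv (⇑ψ ∘ start) len (A.filter fun κ => ¬ Cut C start len κ) := by
  intro κ hκ κ' hκ' hne o ho o' ho'
  rw [Finset.mem_filter] at hκ hκ'
  have tκ := stepMap_pow_apply hψ (start κ) (L := len κ) (fun o h hm => hκ.2 ⟨o, h, hm⟩) o ho
  have tκ' := stepMap_pow_apply hψ (start κ') (L := len κ') (fun o h hm => hκ'.2 ⟨o, h, hm⟩) o' ho'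
  rw [Function.comp_apply, Function.comp_apply, ← tκ, ← tκ', ne_eq, ψ.injective.eq_iff]
  exact hd κ hκ.1 κ' hκ'.1 hne o ho o' ho'

/-- **Tracking along `Reach t`** ([Heuer2020, proof of Lemma 4.6]): the composite position map
`Φ` and the final letters (`U (Φ x) = U₀ x`, `ofFn U` a rotation of the target), a set of
surviving intervals of the family with at most `4t` casualties, rigid motion of the survivors,
and `Reach t` between the readings of every marking before and after. [cite: Heuer2020, Lemma 4.6] -/
theorem exists_track (start : ι → Fin N) (len : ι → ℕ) :
    ∀ {t : ℕ} {U₀ : Fin N → γ} {w : List γ} (_ : Reach t (List.ofFn U₀) w) (A : Finset ι) (_ : DisjointIv start len A),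
      ∃ (Φ : Perm (Fin N)) (U : Fin N → γ) (S : Finset ι),
        List.IsRotated (List.ofFn U) w ∧ (∀ x, U (Φ x) = U₀ x) ∧ S ⊆ A ∧ (A \ S).card ≤ 4 * t ∧
        (∀ κ ∈ S, ∀ o, o < len κ → Φ ((finRotate N ^ o) (start κ)) = (finRotate N ^ o) (Φ (start κ))) ∧
        ∀ (β : Type u) (M : Fin N → Option β), Reach t (readMarks M) (readMarks (M ∘ ⇑Φ.symm))
  | 0, U₀, w, h, A, _ =>
    ⟨1, U₀, A, h, fun _ => rfl, subset_rfl, by simp, fun _ _ _ _ => rfl, fun _ M => by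
      rw [reach_zero, show M ∘ ⇑(1 : Perm (Fin N)).symm = M from funext fun _ => rfl]⟩
  | t + 1, U₀, w, h, A, hd => by
    classical
    obtain ⟨u₁, h₁, hrest⟩ := h
    have hlen : u₁.length = N := by rw [← h₁.length_eq, List.length_ofFn]
    obtain ⟨U₁, rfl⟩ := exists_eq_ofFn hlen
    obtain ⟨ψ, C, hψ, hU₁, hread⟩ := exists_stepMap h₁
    obtain ⟨Φ', U, S', hrot, hU, hS', hcard', hrig', hread'⟩ :=
      exists_track (⇑ψ ∘ start) len hrest (A.filter fun κ => ¬ Cut C start len κ) (hd.step hψ)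
    refine ⟨Φ' * ψ, U, S', hrot, fun x => by rw [Perm.mul_apply, hU, hU₁],
      hS'.trans (Finset.filter_subset _ _), ?_, fun κ hκ o ho => ?_, fun β M => ?_⟩
    · -- casualties: at most `4` newly cut plus `4t` later
      have h4 : (A.filter (Cut C start len)).card ≤ 4 := card_filter_cut_le hψ.1 hd
      have hsplit : A \ S' ⊆ A.filter (Cut C start len) ∪ ((A.filter fun κ => ¬ Cut C start len κ) \ S') := by
        intro κ hκ
        rw [Finset.mem_sdiff] at hκ
        rw [Finset.mem_union, Finset.mem_filter, Finset.mem_sdiff, Finset.mem_filter]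
        by_cases hc : Cut C start len κ
        · exact Or.inl ⟨hκ.1, hc⟩
        · exact Or.inr ⟨⟨hκ.1, hc⟩, hκ.2⟩
      refine (Finset.card_le_card hsplit).trans ((Finset.card_union_le _ _).trans ?_)
      omega
    · -- rigid motion: first `ψ` (uncut at this step), then `Φ'`
      have hκA : κ ∈ A.filter fun κ => ¬ Cut C start len κ := hS' hκ
      rw [Finset.mem_filter] at hκA
      rw [Perm.mul_apply, Perm.mul_apply, stepMap_pow_apply hψ (start κ) (L := len κ) (fun o h hm => hκA.2 ⟨o, h, hm⟩) o ho]
      exact hrig' κ hκ o ho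
    · -- readings: one interchange now, `t` more later
      have h1 := hread β M
      have h2 := hread' β (M ∘ ⇑ψ.symm)
      rw [show (M ∘ ⇑ψ.symm) ∘ ⇑Φ'.symm = M ∘ ⇑(Φ' * ψ).symm from by
        funext x; simp [Perm.mul_def]] at h2
      exact ⟨_, h1, h2⟩

end Track

end CBI

end Literature.GroupTheory.CombinatorialGroupTheory
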